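import Summits.AtomisticToContinuum.BoseEinsteinCondensation.Theorems.BECThomsonPrincipleGDTransferSeededCompactDefs
import Summits.AtomisticToContinuum.BoseEinsteinCondensation.Theorems.BECConjugateDominationHardCoreExtensionResidueAEClass

/-!
# Route `BECThomsonPrinciple`, crux `GDTransfer` (stmt-AtomisticToContinuum-9482), line `seeded-continuity`:
# registered stub `stub_compactLimitAE` (skeleton v8, statement (C) `CompactLimitAE`)

Supports (does not close) stmt-AtomisticToContinuum-9482.  Proves the registered stub
`stub_compactLimitAE : Sig.stub_compactLimitAE` of `BECThomsonPrincipleGDTransferSeededCompactDefs.lean`: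
**Rellich + Fatou with a.e.-convergent pair interactions.**  At fixed `(N, L)`, `L > 0`, let `v` and `w k`
(`k : ℕ`) be measurable profiles whose configuration-space pair interactions converge a.e.,
`Σ_{i<j} (w k)^per(xᵢ − xⱼ) → Σ_{i<j} v^per(xᵢ − xⱼ)`, and let `Ψ k` be periodic `C¹` Bose trial
states with `E_{w k}[Ψ k] ≤ C + e k`, `e k ≤ 1`, `e k → 0`, `C < ⊤`.  Then along a subsequence the embedded
classes `ι(graphEmbed (Ψ k))` (FREE form domain of `PeriodicFormDomain.lean`) converge in `L²((ℝ/ℤ)^{3N})`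
to a unit `η`, Bose-symmetric in momentum space, of MAXIMAL-form energy
`∑ₙ (2πn/L)² |⟪eₙ, η⟫|² + ∫ (W_v ∘ fromUnitTorusN) |η|² ≤ C`.

The proof is the landed monotone-tower case `exists_limitProfile_of_seq`
(`…HardCoreExtensionTruncationReduction.lean`) with ONE Fatou along the a.e.-convergent weights in place of
"Fatou at each truncation height, then Beppo Levi": the uniform bound `E_{w k}[Ψ k] ≤ C + 1` puts the graphs
in a ball of the free form domain, Rellich (`isCompactOperator_formEmbed`) extracts an `L²`-convergent
subsequence, a further subsequence converges a.e. on the torus; the configuration-space a.e. convergence of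
the weights is transported to the torus (`ae_comp_fromUnitTorusN_of_ae`), so at a.e. `t` the products
`W_{w k}(t) |ι(graphEmbed (Ψ k))(t)|²` converge to `W_v(t) |η(t)|²` wherever `η t ≠ 0` (where `η t = 0`
the target is `0`); Fatou, the lower semicontinuity of the spectral kinetic energy and
`liminf (C + e k) = C` give the bound.

References: ReedSimonIV1978 Thm XIII.64 (Rellich), §XIII.12; B. Simon, J. Operator Theory 1 (1979) 37–47
(maximal forms); LSSY2005 Ch. 2 (2.1).
-/

noncomputable section

open MeasureTheory Filter UnitAddTorus
open scoped ENNReal NNReal Topology InnerProductSpace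

namespace Summit.AtomisticToContinuum.BoseEinsteinCondensation.Cruxes.GDTransfer.Seeded

open Literature.MathematicalPhysics.QuantumManyBody.BoseGas
open Summit.AtomisticToContinuum.BoseEinsteinCondensation.Cruxes.StaticResponseBound.UvThomsonForceWave
open Summit.AtomisticToContinuum.BoseEinsteinCondensation.Cruxes.HardCoreExtension.ThirdLawCurrentFloorAlt
  (ae_comp_fromUnitTorusN_of_ae)

-- The measure on `ℝ/ℤ` is the Haar PROBABILITY measure, as in `PeriodicFormDomain.lean`.
attribute [local instance] Literature.MathematicalPhysics.QuantumManyBody.BoseGas.formDomain_measureSpace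
  Literature.MathematicalPhysics.QuantumManyBody.BoseGas.formDomain_isProbabilityMeasure
  Literature.MathematicalPhysics.QuantumManyBody.BoseGas.formDomain_isProbabilityMeasure_pi

/-- **Registered stub `stub_compactLimitAE` (C) of skeleton v8: Rellich + Fatou with a.e.-convergent pair
interactions.**  For `L > 0`, measurable `v`, measurable `w k` with
`Σ (w k)^per(xᵢ − xⱼ) → Σ v^per(xᵢ − xⱼ)` for a.e. configuration, `C ≠ ⊤`, `e k ≤ 1`, `e k → 0` and trial
states with `E_{w k}[Ψ k] ≤ C + e k`, a subsequence of the embedded classes `ι(graphEmbed (Ψ k))` (free form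
domain) converges in `L²((ℝ/ℤ)^{3N})` to a unit `η`, Bose-symmetric in momentum space, with maximal-form
energy for `v` at most `C`.
[cite: ReedSimonIV1978, Thm. XIII.64] -/
theorem stub_compactLimitAE : Sig.stub_compactLimitAE := by
  intro N L hL v hv w hw hwv C hC e he1 he0 Ψ hΨ
  -- the uniform energy bound `B = C + 1`
  set B : ℝ≥0∞ := C + 1 with hBdef
  have hB : B ≠ ⊤ := ENNReal.add_ne_top.2 ⟨hC, ENNReal.one_ne_top⟩
  have hΨB : ∀ k, periodicEnergy (w k) (Ψ k) ≤ B := fun k => (hΨ k).trans (add_le_add le_rfl (he1 k))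
  -- the FREE form domain as a compactness device
  set g : ℕ → formDomain hL measurable_zeroProfile (lintegral_periodicInteraction_zero_ne_top N L) :=
    fun n => ⟨graphEmbed hL measurable_zeroProfile (lintegral_periodicInteraction_zero_ne_top N L)
      ⟨(Ψ n).ψ, (Ψ n).mem_periodicCore⟩, graphEmbed_mem_formDomain _ _ _ _⟩ with hg
  set f : ℕ → Lp ℂ 2 (volume : Measure (UnitAddTorus (Fin N × Fin 3))) := fun n =>
    formEmbed hL measurable_zeroProfile (lintegral_periodicInteraction_zero_ne_top N L) (g n) with hf
  have hf1 : ∀ n, ‖f n‖ = 1 := fun n =>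
    norm_formEmbed_graphEmbed_trialState hL measurable_zeroProfile
      (lintegral_periodicInteraction_zero_ne_top N L) (Ψ n)
  have hkin_le : ∀ n, ∫⁻ X in cellN N L, kineticDensity (Ψ n).ψ X ≤ B := fun n =>
    (Literature.MathematicalPhysics.QuantumManyBody.BoseGas.lintegral_kineticDensity_le_periodicEnergy (w n)
      (Ψ n)).trans (hΨB n)
  have hgn : ∀ n, ‖g n‖ ^ 2 ≤ 1 + B.toReal := fun n => by
    have h1 : ‖g n‖ = ‖graphEmbed hL measurable_zeroProfile (lintegral_periodicInteraction_zero_ne_top N L)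
        ⟨(Ψ n).ψ, (Ψ n).mem_periodicCore⟩‖ := rfl
    rw [h1, norm_graphEmbed_sq_trialState, periodicEnergy_zero_eq]
    linarith [ENNReal.toReal_mono hB (hkin_le n)]
  -- Rellich: an `L²`-convergent subsequence of the embedded states
  set R : ℝ := Real.sqrt (1 + B.toReal) + 1 with hR
  have hball : ∀ n, g n ∈ Metric.ball (0 : formDomain hL measurable_zeroProfile
      (lintegral_periodicInteraction_zero_ne_top N L)) R := fun n => by
    rw [Metric.mem_ball, dist_zero_right]
    have h := Real.abs_le_sqrt (hgn n)
    rw [abs_of_nonneg (norm_nonneg _)] at h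
    linarith
  have hK : IsCompact (closure ((formEmbed hL measurable_zeroProfile
      (lintegral_periodicInteraction_zero_ne_top N L)) '' Metric.ball 0 R)) :=
    (isCompactOperator_formEmbed hL measurable_zeroProfile
      (lintegral_periodicInteraction_zero_ne_top N L)).isCompact_closure_image_ball
      (f := (formEmbed hL measurable_zeroProfile (lintegral_periodicInteraction_zero_ne_top N L) :
        formDomain hL measurable_zeroProfile (lintegral_periodicInteraction_zero_ne_top N L) →ₗ[ℂ]
          Lp ℂ 2 (volume : Measure (UnitAddTorus (Fin N × Fin 3))))) R
  obtain ⟨η, -, φ, hφ, hconv⟩ := hK.tendsto_subseq (x := f) fun n => subset_closure ⟨g n, hball n, rfl⟩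
  -- an a.e.-convergent further subsequence
  obtain ⟨ns, hns, hae⟩ := (tendstoInMeasure_of_tendsto_Lp hconv).exists_seq_tendsto_ae
  set ψ : ℕ → ℕ := φ ∘ ns with hψdef
  have hψ : StrictMono ψ := hφ.comp hns
  have hconvψ : Tendsto (fun i => f (ψ i)) atTop (𝓝 η) := hconv.comp hns.tendsto_atTop
  refine ⟨η, ψ, hψ, hconvψ, ?_, ?_, ?_⟩
  · -- `‖η‖ = 1`
    have h1 : Tendsto (fun i => ‖f (ψ i)‖) atTop (𝓝 ‖η‖) := (continuous_norm.tendsto η).comp hconvψ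
    simp only [hf1] at h1
    exact tendsto_nhds_unique h1 tendsto_const_nhds
  · -- Bose symmetry in momentum space passes to the limit
    intro σ n
    have hc : ∀ m : Fin N × Fin 3 → ℤ,
        Continuous fun x : Lp ℂ 2 (volume : Measure (UnitAddTorus (Fin N × Fin 3))) =>
          ⟪(mFourierLp 2 m : Lp ℂ 2 (volume : Measure (UnitAddTorus (Fin N × Fin 3)))), x⟫_ℂ :=
      fun m => continuous_const.inner continuous_id
    have h1 := ((hc (fun p : Fin N × Fin 3 => n (σ p.1, p.2))).tendsto η).comp hconvψ
    have h2 := ((hc n).tendsto η).comp hconvψ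
    have h12 : (fun x : Lp ℂ 2 (volume : Measure (UnitAddTorus (Fin N × Fin 3))) =>
            ⟪(mFourierLp 2 (fun p : Fin N × Fin 3 => n (σ p.1, p.2)) :
              Lp ℂ 2 (volume : Measure (UnitAddTorus (Fin N × Fin 3)))), x⟫_ℂ) ∘ (fun i => f (ψ i)) =
        (fun x : Lp ℂ 2 (volume : Measure (UnitAddTorus (Fin N × Fin 3))) =>
            ⟪(mFourierLp 2 n : Lp ℂ 2 (volume : Measure (UnitAddTorus (Fin N × Fin 3)))), x⟫_ℂ) ∘
          (fun i => f (ψ i)) := by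
      funext i
      simp only [Function.comp_apply, hf]
      rw [inner_mFourierLp_formEmbed_trialState, inner_mFourierLp_formEmbed_trialState,
        configFourierCoeff_perm (Ψ (ψ i)).symm]
    rw [h12] at h1
    exact tendsto_nhds_unique h1 h2
  · -- the energy bound: measurability of the weights
    have hWk : ∀ k, Measurable (periodicInteraction (N := N) (w k) L) := fun k =>
      measurable_periodicInteraction_trunc (hw k) L
    -- the a.e. convergence of the weights, transported to the torus
    have haeW : ∀ᵐ t ∂(volume : Measure (UnitAddTorus (Fin N × Fin 3))),
        Tendsto (fun k => periodicInteraction (w k) L (fromUnitTorusN L t)) atTop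
          (𝓝 (periodicInteraction v L (fromUnitTorusN L t))) :=
      ae_comp_fromUnitTorusN_of_ae hL hwv
    -- lower semicontinuity of the kinetic energy
    have hkin : ∑' n : Fin N × Fin 3 → ℤ, ENNReal.ofReal (∑ p, (2 * Real.pi * (n p : ℝ) / L) ^ 2) *
          (‖⟪(mFourierLp 2 n : Lp ℂ 2 (volume : Measure (UnitAddTorus (Fin N × Fin 3)))), η⟫_ℂ‖₊ :
            ℝ≥0∞) ^ 2 ≤
        liminf (fun i => ∫⁻ X in cellN N L, kineticDensity (Ψ (ψ i)).ψ X) atTop := by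
      have h := tsum_mul_inner_sq_le_liminf
        (fun n : Fin N × Fin 3 → ℤ =>
          (mFourierLp 2 n : Lp ℂ 2 (volume : Measure (UnitAddTorus (Fin N × Fin 3)))))
        (w := fun n : Fin N × Fin 3 → ℤ => ENNReal.ofReal (∑ p, (2 * Real.pi * (n p : ℝ) / L) ^ 2))
        (fun _ => ENNReal.ofReal_ne_top) hconvψ
      refine h.trans_eq ?_
      congr 1
      funext i
      exact tsum_kinetic_formEmbed_trialState hL (Ψ (ψ i))
    -- Fatou for the potential energy, ONCE, with the `k`-dependent weights
    have hpot : ∫⁻ t, periodicInteraction v L (fromUnitTorusN L t) *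
          (‖(η : UnitAddTorus (Fin N × Fin 3) → ℂ) t‖₊ : ℝ≥0∞) ^ 2 ≤
        liminf (fun i => ∫⁻ X in cellN N L, periodicInteraction (w (ψ i)) L X *
          (‖(Ψ (ψ i)).ψ X‖₊ : ℝ≥0∞) ^ 2) atTop := by
      calc ∫⁻ t, periodicInteraction v L (fromUnitTorusN L t) *
            (‖(η : UnitAddTorus (Fin N × Fin 3) → ℂ) t‖₊ : ℝ≥0∞) ^ 2
          ≤ ∫⁻ t, liminf (fun i => periodicInteraction (w (ψ i)) L (fromUnitTorusN L t) *
              (‖(f (ψ i) : UnitAddTorus (Fin N × Fin 3) → ℂ) t‖₊ : ℝ≥0∞) ^ 2) atTop := by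
            refine lintegral_mono_ae ?_
            filter_upwards [hae, haeW] with t ht htW
            by_cases h0 : (‖(η : UnitAddTorus (Fin N × Fin 3) → ℂ) t‖₊ : ℝ≥0∞) = 0
            · rw [h0, zero_pow two_ne_zero, mul_zero]
              exact bot_le
            have hsq : Tendsto
                (fun i => (‖(f (ψ i) : UnitAddTorus (Fin N × Fin 3) → ℂ) t‖₊ : ℝ≥0∞) ^ 2) atTop
                (𝓝 ((‖(η : UnitAddTorus (Fin N × Fin 3) → ℂ) t‖₊ : ℝ≥0∞) ^ 2)) :=
              ((ENNReal.continuous_pow 2).tendsto _).comp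
                ((ENNReal.continuous_coe.tendsto _).comp ht.nnnorm)
            have hW : Tendsto (fun i => periodicInteraction (w (ψ i)) L (fromUnitTorusN L t)) atTop
                (𝓝 (periodicInteraction v L (fromUnitTorusN L t))) := htW.comp hψ.tendsto_atTop
            have hprod := ENNReal.Tendsto.mul hW (Or.inr (ENNReal.pow_ne_top ENNReal.coe_ne_top)) hsq
              (Or.inl (pow_ne_zero 2 h0))
            rw [← hprod.liminf_eq]
        _ ≤ liminf (fun i => ∫⁻ t, periodicInteraction (w (ψ i)) L (fromUnitTorusN L t) *
              (‖(f (ψ i) : UnitAddTorus (Fin N × Fin 3) → ℂ) t‖₊ : ℝ≥0∞) ^ 2) atTop :=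
            lintegral_liminf_le' fun i => (((hWk (ψ i)).comp (measurable_fromUnitTorusN L)).aemeasurable.mul
              ((Lp.aestronglyMeasurable (f (ψ i))).aemeasurable.nnnorm.coe_nnreal_ennreal.pow_const 2))
        _ = liminf (fun i => ∫⁻ X in cellN N L, periodicInteraction (w (ψ i)) L X *
              (‖(Ψ (ψ i)).ψ X‖₊ : ℝ≥0∞) ^ 2) atTop := by
            congr 1
            funext i
            exact lintegral_pot_formEmbed_trialState hL (Ψ (ψ i)) (hWk (ψ i))
    -- combine and use the energy bound `E_{w (ψ i)}[Ψ (ψ i)] ≤ C + e (ψ i)`, `e (ψ i) → 0`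
    set KINi : ℕ → ℝ≥0∞ := fun i => ∫⁻ X in cellN N L, kineticDensity (Ψ (ψ i)).ψ X with hKINi
    set POTi : ℕ → ℝ≥0∞ := fun i => ∫⁻ X in cellN N L, periodicInteraction (w (ψ i)) L X *
        (‖(Ψ (ψ i)).ψ X‖₊ : ℝ≥0∞) ^ 2 with hPOTi
    have hsum : ∀ i, KINi i + POTi i = periodicEnergy (w (ψ i)) (Ψ (ψ i)) := fun i => by
      simp only [hKINi, hPOTi, periodicEnergy]
      rw [← lintegral_add_left (measurable_kineticDensity_any (Ψ (ψ i)).ψ)]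
    have hev : ∀ᶠ i in atTop, KINi i + POTi i ≤ C + e (ψ i) :=
      Eventually.of_forall fun i => (hsum i).le.trans (hΨ (ψ i))
    have hCe : Tendsto (fun i => C + e (ψ i)) atTop (𝓝 C) := by
      have h := (tendsto_const_nhds (x := C)).add (he0.comp hψ.tendsto_atTop)
      rwa [add_zero] at h
    calc _ ≤ liminf KINi atTop + liminf POTi atTop := add_le_add hkin hpot
      _ ≤ liminf (fun i => KINi i + POTi i) atTop := liminf_add_liminf_le KINi POTi
      _ ≤ liminf (fun i => C + e (ψ i)) atTop := liminf_le_liminf hev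
      _ = C := hCe.liminf_eq

end Summit.AtomisticToContinuum.BoseEinsteinCondensation.Cruxes.GDTransfer.Seeded

end
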